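import Summits.ABC.IUTFork.Cor312LicenceTripleLocalTypeSlotDiff
import Summits.ABC.IUTFork.Cor312GenuineKWildDifferentExactTriple
import Summits.ABC.IUTFork.Cor312GenuineKWildExactTriple
import Summits.ABC.IUTFork.Conditional.RefBandsInhCells99794037551104Diff
import Summits.ABC.IUTFork.Conditional.AbcOfSGenuineKTameRobustRows5
import HarnessLib

/-!
# R-W «W:TS-BANDS» / «W2-EXACT-DIFFERENT INH», INH-type half: `2 ^ 12 * 13 ^ 3 * 223 ^ 3 + 3 ^ 15 * 11 ^ 3 * 97 ^ 5 * 409 = 5 ^ 15 * 179 ^ 4 * 2141` — S_H INHABITED at every datum with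
# `e(·|97) = 6·l`, EVERY prime `l ≥ 4091` (gen 4's `RefBandsInhTypeBand99794037551104`: `l ≥ 5183`) — the W2-EXACT different at the pole `5`

PROOF-ONLY file (D-0012: 0 definitions, 0 `Prop` facts, no instance, no notation) of the abc-iut cell — D-0079 RESCUE sub-cell R-W «WINDOW Θ-SIDE
INEQUALITY», numerics-crew seat abc-iut-W-num-6 (gen 5), item «W2-EXACT-DIFFERENT INH» (abc-iut-plan g12 C-R111 (b) / C-R112 (b); routing fact of
abc-iut-W-num-5 g5 / abc-iut-rw-num-lead g4: the 128 primes `4091 ≤ l ≤ 5179` of the type `e(·|97) = 6l` are inhabited once the socket reads the W2-EXACT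
different at `5`). GENERATED by this seat's `work/inhlevels/emit_diff223.py` from the gen-4 type band (verbatim but for the socket and the threshold).

CONTENT. The gen-4 file proved the INH-type half from `l ≥ 5183` over abc-iut-W-row-1's hooked slot socket, whose different input at `p = 5` is Hensel's
`e − 1`. Here the SAME two theorems from `l ≥ 4091` over this seat's different-hook socket `WRow.licence_triple_slot_of_localType_diff`
(`Cor312LicenceTripleLocalTypeSlotDiff` = W-row-1's socket verbatim with the different at one prime read from a caller theorem): at `p₀ = 5` the different is
`d = (e + e/5 − 1)/e` EXACTLY by abc-iut-w5-d180's `GenuineK.differentOrd_kOf_eq_wildUnit_of_triple` (`Cor312GenuineKWildDifferentExactTriple`; unit test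
`5 ∥ ((abc/5¹⁵)²)⁴ − (2⁸(cb + a²)³)⁴` by `norm_num`), the type at `5` is `e = 20l` EXACTLY by abc-iut-W-neg-2's `GenuineK.absRamificationIdx_kOf_eq_wildUnit_of_triple`
(as in gen 4), the hook `97 = p → e = 6l` is the hypothesis `hloc`, and the arithmetic is `RefBand.inhcell_99794037551104_type_diff` (`RefBandsInhCells99794037551104Diff`).
For EVERY prime `l ≥ 4091` and EVERY genuine Θ-volume datum `T` whose places over `97` have `e(K_x/ℚ_97) = 6·l`: the licence HOLDS at
`settingPrVolSharp (pilotDataOfK T.D T.K) …` for every pair of realising ideles (`WRow.licence_triple_99794037551104_typeband_e6_diff`) and so does branch C's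
antecedent (`WRow.exists_qPinned_and_hull_triple_99794037551104_typeband_e6_diff`). AXIS READING (type `6l` at `97`): REF ∀T below `4091` by the files of record,
INH here from `4091` ⇒ no prime of this type left between; the other member `3l`: REF-type `≤ 6129` (+ level `6131`), `6133` a +1-radius tie, ∀T INH `≥ 6137`.
HONEST SCOPE: a PER-TYPE statement (it binds the local type at `97` only); inhabited-AS-TYPED over OUR objects; admissibility / non-emptiness of the datum
type (and of the sub-class) NOT claimed; nothing about the number-level `Cor22.Cor312AtDatum`; typed ≠ proved; no side taken on [IUTchIII] Cor. 3.12; no abc claim.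
-/

noncomputable section

open Set Function Metric NumberField IsDedekindDomain

namespace Summit.ABC.IUTFork.Conditional

open Thm311 Thm311.Real Cor312 Cor312Vol Cor312Prov Literature.IUT.LogThetaLattice Literature.IUT.LogVolume
  Literature.IUT.HodgeTheaters Literature.IUT.LogVolume.Cor22
open Literature.NumberTheory.NumberFields Literature.NumberTheory.GaloisRepresentations.Ultrametric
open Literature.NumberTheory.DiophantineGeometry Literature.NumberTheory.DiophantineGeometry.GenEll

/-- **INH-TYPE BAND (W2-EXACT different at `5`): `2 ^ 12 * 13 ^ 3 * 223 ^ 3 + 3 ^ 15 * 11 ^ 3 * 97 ^ 5 * 409 = 5 ^ 15 * 179 ^ 4 * 2141` at EVERY prime `l ≥ 4091`, data with `e(·|97) = 6·l`.** For every genuine Θ-volume datum `T` at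
`(ratPoint (a/c), l)` whose places over `97` have `e(K_x/ℚ_97) = 6·l` and every pair of realising Θ- and q-ideles:
`Thm311ToCor312.Licence (settingPrVolSharp (pilotDataOfK T.D T.K) …)` — the different-hook socket `WRow.licence_triple_slot_of_localType_diff` (W-row-1's hooked socket verbatim + `D = e + e/5 − 1` at `5` by abc-iut-w5-d180's exact W2 different; hook
`p = 97 → e = 6·l`) at `RefBand.inhcell_99794037551104_type_diff` (envelope exponents `if p = 3 then 7 else if p = 5 then 7 else if p = 11 then 1 else if p = 13 then 1 else if p = 97 then 2 else if p = 179 then 1 else if p = 223 then 1 else if p = 409 then 0 else if p = 2141 then 0 else 0`). [cite: Mochizuki2012, IUTchI Def. 3.1 (b),(c) pp. 61–62, Ex. 3.2 (iv) p. 71; IUTchIII Cor. 3.12 Step (xi-f) p. 184; IUTchIV Prop. 1.1 p. 9, Prop. 1.2 (i)(ii) p. 10, Cor. 2.2 (ii) proof (P5) p. 46]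
[cite: DupuyHilado2025, §3.3, §3.4, §4.9, §4.12] [claim: Mochizuki2012, status: disputed] -/
theorem WRow.licence_triple_99794037551104_typeband_e6_diff {l : ℕ} (hl : l.Prime) (hl0 : 4091 ≤ l)
    (T : Cor22.ThetaVolumeDatumAt (ratPoint (((2 ^ 12 * 13 ^ 3 * 223 ^ 3 : ℕ) : ℚ) / (5 ^ 15 * 179 ^ 4 * 2141 : ℕ))) l)
    (hloc : letI := T.instFieldF; letI := T.instNumberFieldF; letI := T.instAlgebraF; letI := T.instFieldK
      letI := T.instNumberFieldK; letI := T.instAlgebraK; letI := T.instFieldFbar; letI := T.instAlgebraFbar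
      letI := T.instAlgebraKFbar; letI := T.instIsElliptic
      haveI : Fact (Nat.Prime 97) := ⟨by norm_num⟩
      ∀ x₀ : (thetaIndex (pilotDataOfK T.D T.K)).Fibre (.inr ⟨97, by norm_num⟩),
        absRamificationIdx 97 (kOf (pilotDataOfK T.D T.K) 97 x₀) = 6 * l) :
    letI := T.instFieldF; letI := T.instNumberFieldF; letI := T.instAlgebraF; letI := T.instFieldK
    letI := T.instNumberFieldK; letI := T.instAlgebraK; letI := T.instFieldFbar; letI := T.instAlgebraFbar
    letI := T.instAlgebraKFbar; letI := T.instIsElliptic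
    ∀ {logv : PadicLogs T.K} (hlog : LogvAnalytic logv) (M : Type) [Field M] [NumberField M]
      (archPk : ∀ (j : (thetaIndex (pilotDataOfK T.D T.K)).Label) (vQ : (thetaIndex (pilotDataOfK T.D T.K)).VQ),
        Set ((logShellsDH (pilotDataOfK T.D T.K) logv).Packet j vQ))
      (archSub : ∀ (j : (thetaIndex (pilotDataOfK T.D T.K)).Label) (v : (thetaIndex (pilotDataOfK T.D T.K)).V),
        Set ((logShellsDH (pilotDataOfK T.D T.K) logv).Packet j ((thetaIndex (pilotDataOfK T.D T.K)).over v)))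
      (Ψ : ℤ → ∀ v : (thetaIndex (pilotDataOfK T.D T.K)).V, v ∈ (thetaIndex (pilotDataOfK T.D T.K)).Vbad →
        Set ((logShellsDH (pilotDataOfK T.D T.K) logv).StarPacket v))
      (act : ℤ → ∀ v : (thetaIndex (pilotDataOfK T.D T.K)).V, v ∈ (thetaIndex (pilotDataOfK T.D T.K)).Vbad →
        (logShellsDH (pilotDataOfK T.D T.K) logv).StarPacket v → Module.End ℚ ((logShellsDH (pilotDataOfK T.D T.K) logv).StarPacket v))
      (Mmod : ℤ → ∀ j : (thetaIndex (pilotDataOfK T.D T.K)).LabelStar, Set ((logShellsDH (pilotDataOfK T.D T.K) logv).GlobalPacket j.1))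
      (region : ℤ → ∀ j : (thetaIndex (pilotDataOfK T.D T.K)).LabelStar, FinDivisor M → ∀ vQ : (thetaIndex (pilotDataOfK T.D T.K)).VQ,
        Set ((logShellsDH (pilotDataOfK T.D T.K) logv).Packet j.1 vQ))
      (n : ℤ) {HT : Type} {LogLink : HT → HT → Type} {IsFull : ∀ {s t : HT}, LogLink s t → Prop}
      (lat : LGPGaussianLogThetaLattice LogLink IsFull)
      {Frd : Type} {IsoF : Frd → Frd → Type} {Ob : Frd → Type} {realify : Frd → Frd} {Strip : Type}
      {IsoS : Strip → Strip → Type} {Mv : ∀ v : (thetaIndex (pilotDataOfK T.D T.K)).V, v ∈ (thetaIndex (pilotDataOfK T.D T.K)).Vbad → Type}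
      [∀ v h, Monoid (Mv v h)]
      (sig : GlobalLGPFrobenioidSignature (thetaIndex (pilotDataOfK T.D T.K)).lstar (thetaIndex (pilotDataOfK T.D T.K)).V
        (· ∈ (thetaIndex (pilotDataOfK T.D T.K)).Vbad) Frd IsoF Ob realify Strip IsoS Mv)
      (split : SplittingMonoids Mv) {ObΔ : Type} {N : ∀ v : (thetaIndex (pilotDataOfK T.D T.K)).V, v ∈ (thetaIndex (pilotDataOfK T.D T.K)).Vbad → Type}
      [∀ v h, Monoid (N v h)] (qData : QPilotData ObΔ N)
      (tq : ∀ (pp : Nat.Primes) (x : (thetaIndex (pilotDataOfK T.D T.K)).Fibre (.inr pp)),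
        haveI : Fact (pp : ℕ).Prime := ⟨pp.2⟩; kOf (pilotDataOfK T.D T.K) pp.1 x)
      (t : ∀ (pp : Nat.Primes) (_ : Fin (pilotDataOfK T.D T.K).lstar) (x : (thetaIndex (pilotDataOfK T.D T.K)).Fibre (.inr pp)),
        haveI : Fact (pp : ℕ).Prime := ⟨pp.2⟩; kOf (pilotDataOfK T.D T.K) pp.1 x)
      (htq0 : ∀ pp x, tq pp x ≠ 0)
      (htq1 : ∀ (pp : Nat.Primes) (x : (thetaIndex (pilotDataOfK T.D T.K)).Fibre (.inr pp)),
        haveI : Fact (pp : ℕ).Prime := ⟨pp.2⟩; placeOf (pilotDataOfK T.D T.K) pp.1 x ∉ (pilotDataOfK T.D T.K).S → ‖tq pp x‖ = 1)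
      (_ht0 : ∀ pp i x, t pp i x ≠ 0)
      (_ht : ∀ (pp : Nat.Primes) (i : Fin (pilotDataOfK T.D T.K).lstar) (x : (thetaIndex (pilotDataOfK T.D T.K)).Fibre (.inr pp)),
        haveI : Fact (pp : ℕ).Prime := ⟨pp.2⟩
        Real.log ‖t pp i x‖ = -((pilotDataOfK T.D T.K).thetaPilot i (placeOf (pilotDataOfK T.D T.K) pp.1 x)) *
          logNorm T.K (placeOf (pilotDataOfK T.D T.K) pp.1 x) / localDegree T.K (placeOf (pilotDataOfK T.D T.K) pp.1 x))
      (_htq : ∀ (pp : Nat.Primes) (x : (thetaIndex (pilotDataOfK T.D T.K)).Fibre (.inr pp)),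
        haveI : Fact (pp : ℕ).Prime := ⟨pp.2⟩
        Real.log ‖tq pp x‖ = -((pilotDataOfK T.D T.K).qPilot (placeOf (pilotDataOfK T.D T.K) pp.1 x)) *
          logNorm T.K (placeOf (pilotDataOfK T.D T.K) pp.1 x) / localDegree T.K (placeOf (pilotDataOfK T.D T.K) pp.1 x)),
      Thm311ToCor312.Licence
        (settingPrVolSharp (pilotDataOfK T.D T.K) hlog M archPk archSub Ψ act Mmod region n lat sig split qData tq t htq0 htq1) :=
  WRow.licence_triple_slot_of_localType_diff isABCTriple_frey99794037551104 (by rw [Cor22.jInv_ratPoint_triple isABCTriple_frey99794037551104]; norm_num) T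
    (fun p => if p = 3 then 7 else if p = 5 then 7 else if p = 11 then 1 else if p = 13 then 1 else if p = 97 then 2 else if p = 179 then 1 else if p = 223 then 1 else if p = 409 then 0 else if p = 2141 then 0 else 0) (fun p => if p = 3 then 7 else if p = 5 then 7 else if p = 11 then 1 else if p = 13 then 1 else if p = 97 then 2 else if p = 179 then 1 else if p = 223 then 1 else if p = 409 then 0 else if p = 2141 then 0 else 0) (fun p e => (5 = p → e = 20 * l) ∧ (97 = p → e = 6 * l))
    (by
      intro pp x _
      refine ⟨fun hpp => ?_, fun hpp => ?_⟩
      · obtain rfl : pp = ⟨5, by norm_num⟩ := Subtype.ext hpp.symm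
        have h := GenuineK.absRamificationIdx_kOf_eq_wildUnit_of_triple (p' := 3) (v := 15) isABCTriple_frey99794037551104 T ⟨5, by norm_num⟩
          (Or.inr ⟨rfl, rfl⟩) (by simp; omega) (by norm_num) (by norm_num) (by norm_num) (by norm_num) (by norm_num) (by norm_num)
        rw [h x]; norm_num
      · obtain rfl : pp = ⟨97, by norm_num⟩ := Subtype.ext hpp.symm
        exact hloc x) 5 (fun e => e + e / 5 - 1)
    (by
      intro pp x _ hpp
      obtain rfl : pp = ⟨5, by norm_num⟩ := Subtype.ext hpp
      have h := GenuineK.differentOrd_kOf_eq_wildUnit_of_triple (p' := 3) (v := 15) isABCTriple_frey99794037551104 T ⟨5, by norm_num⟩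
        (Or.inr ⟨rfl, rfl⟩) (by simp; omega) (by norm_num) (by norm_num) (by norm_num) (by norm_num) (by norm_num) (by norm_num)
      exact (h x).symm.le)
    (RefBand.inhcell_99794037551104_type_diff hl hl0)

/-- **Hence branch C's per-datum antecedent «∃ ρ qK, QPinned ∧ PilotKummerCompatHull» HOLDS** at every such datum (any columns `col`; every pair of
realising Θ- and q-ideles), EVERY prime `l ≥ 4091`, data with `e(·|97) = 6·l`. [cite: Mochizuki2012, IUTchIII Cor. 3.12 Step (xi-d) p. 183, (xi-f) p. 184] [cite: DupuyHilado2025, §3.3, §3.4, §4.9] [claim: Mochizuki2012, status: disputed] -/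
theorem WRow.exists_qPinned_and_hull_triple_99794037551104_typeband_e6_diff {l : ℕ} (hl : l.Prime) (hl0 : 4091 ≤ l)
    (T : Cor22.ThetaVolumeDatumAt (ratPoint (((2 ^ 12 * 13 ^ 3 * 223 ^ 3 : ℕ) : ℚ) / (5 ^ 15 * 179 ^ 4 * 2141 : ℕ))) l)
    (hloc : letI := T.instFieldF; letI := T.instNumberFieldF; letI := T.instAlgebraF; letI := T.instFieldK
      letI := T.instNumberFieldK; letI := T.instAlgebraK; letI := T.instFieldFbar; letI := T.instAlgebraFbar
      letI := T.instAlgebraKFbar; letI := T.instIsElliptic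
      haveI : Fact (Nat.Prime 97) := ⟨by norm_num⟩
      ∀ x₀ : (thetaIndex (pilotDataOfK T.D T.K)).Fibre (.inr ⟨97, by norm_num⟩),
        absRamificationIdx 97 (kOf (pilotDataOfK T.D T.K) 97 x₀) = 6 * l) :
    letI := T.instFieldF; letI := T.instNumberFieldF; letI := T.instAlgebraF; letI := T.instFieldK
    letI := T.instNumberFieldK; letI := T.instAlgebraK; letI := T.instFieldFbar; letI := T.instAlgebraFbar
    letI := T.instAlgebraKFbar; letI := T.instIsElliptic
    ∀ {logv : PadicLogs T.K} (hlog : LogvAnalytic logv) (M : Type) [Field M] [NumberField M]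
      (archPk : ∀ (j : (thetaIndex (pilotDataOfK T.D T.K)).Label) (vQ : (thetaIndex (pilotDataOfK T.D T.K)).VQ),
        Set ((logShellsDH (pilotDataOfK T.D T.K) logv).Packet j vQ))
      (archSub : ∀ (j : (thetaIndex (pilotDataOfK T.D T.K)).Label) (v : (thetaIndex (pilotDataOfK T.D T.K)).V),
        Set ((logShellsDH (pilotDataOfK T.D T.K) logv).Packet j ((thetaIndex (pilotDataOfK T.D T.K)).over v)))
      (Ψ : ℤ → ∀ v : (thetaIndex (pilotDataOfK T.D T.K)).V, v ∈ (thetaIndex (pilotDataOfK T.D T.K)).Vbad →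
        Set ((logShellsDH (pilotDataOfK T.D T.K) logv).StarPacket v))
      (act : ℤ → ∀ v : (thetaIndex (pilotDataOfK T.D T.K)).V, v ∈ (thetaIndex (pilotDataOfK T.D T.K)).Vbad →
        (logShellsDH (pilotDataOfK T.D T.K) logv).StarPacket v → Module.End ℚ ((logShellsDH (pilotDataOfK T.D T.K) logv).StarPacket v))
      (Mmod : ℤ → ∀ j : (thetaIndex (pilotDataOfK T.D T.K)).LabelStar, Set ((logShellsDH (pilotDataOfK T.D T.K) logv).GlobalPacket j.1))
      (region : ℤ → ∀ j : (thetaIndex (pilotDataOfK T.D T.K)).LabelStar, FinDivisor M → ∀ vQ : (thetaIndex (pilotDataOfK T.D T.K)).VQ,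
        Set ((logShellsDH (pilotDataOfK T.D T.K) logv).Packet j.1 vQ))
      (n : ℤ) {HT : Type} {LogLink : HT → HT → Type} {IsFull : ∀ {s t : HT}, LogLink s t → Prop}
      (lat : LGPGaussianLogThetaLattice LogLink IsFull)
      {Frd : Type} {IsoF : Frd → Frd → Type} {Ob : Frd → Type} {realify : Frd → Frd} {Strip : Type}
      {IsoS : Strip → Strip → Type} {Mv : ∀ v : (thetaIndex (pilotDataOfK T.D T.K)).V, v ∈ (thetaIndex (pilotDataOfK T.D T.K)).Vbad → Type}
      [∀ v h, Monoid (Mv v h)]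
      (sig : GlobalLGPFrobenioidSignature (thetaIndex (pilotDataOfK T.D T.K)).lstar (thetaIndex (pilotDataOfK T.D T.K)).V
        (· ∈ (thetaIndex (pilotDataOfK T.D T.K)).Vbad) Frd IsoF Ob realify Strip IsoS Mv)
      (split : SplittingMonoids Mv) {ObΔ : Type} {N : ∀ v : (thetaIndex (pilotDataOfK T.D T.K)).V, v ∈ (thetaIndex (pilotDataOfK T.D T.K)).Vbad → Type}
      [∀ v h, Monoid (N v h)] (qData : QPilotData ObΔ N)
      (tq : ∀ (pp : Nat.Primes) (x : (thetaIndex (pilotDataOfK T.D T.K)).Fibre (.inr pp)),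
        haveI : Fact (pp : ℕ).Prime := ⟨pp.2⟩; kOf (pilotDataOfK T.D T.K) pp.1 x)
      (t : ∀ (pp : Nat.Primes) (_ : Fin (pilotDataOfK T.D T.K).lstar) (x : (thetaIndex (pilotDataOfK T.D T.K)).Fibre (.inr pp)),
        haveI : Fact (pp : ℕ).Prime := ⟨pp.2⟩; kOf (pilotDataOfK T.D T.K) pp.1 x)
      (htq0 : ∀ pp x, tq pp x ≠ 0)
      (htq1 : ∀ (pp : Nat.Primes) (x : (thetaIndex (pilotDataOfK T.D T.K)).Fibre (.inr pp)),
        haveI : Fact (pp : ℕ).Prime := ⟨pp.2⟩; placeOf (pilotDataOfK T.D T.K) pp.1 x ∉ (pilotDataOfK T.D T.K).S → ‖tq pp x‖ = 1)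
      (col : ℤ → Column (logShellsDH (pilotDataOfK T.D T.K) logv))
      (_ht0 : ∀ pp i x, t pp i x ≠ 0)
      (_ht : ∀ (pp : Nat.Primes) (i : Fin (pilotDataOfK T.D T.K).lstar) (x : (thetaIndex (pilotDataOfK T.D T.K)).Fibre (.inr pp)),
        haveI : Fact (pp : ℕ).Prime := ⟨pp.2⟩
        Real.log ‖t pp i x‖ = -((pilotDataOfK T.D T.K).thetaPilot i (placeOf (pilotDataOfK T.D T.K) pp.1 x)) *
          logNorm T.K (placeOf (pilotDataOfK T.D T.K) pp.1 x) / localDegree T.K (placeOf (pilotDataOfK T.D T.K) pp.1 x))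
      (_htq : ∀ (pp : Nat.Primes) (x : (thetaIndex (pilotDataOfK T.D T.K)).Fibre (.inr pp)),
        haveI : Fact (pp : ℕ).Prime := ⟨pp.2⟩
        Real.log ‖tq pp x‖ = -((pilotDataOfK T.D T.K).qPilot (placeOf (pilotDataOfK T.D T.K) pp.1 x)) *
          logNorm T.K (placeOf (pilotDataOfK T.D T.K) pp.1 x) / localDegree T.K (placeOf (pilotDataOfK T.D T.K) pp.1 x)),
      ∃ (ρ : (∀ v : (thetaIndex (pilotDataOfK T.D T.K)).V, v ∈ (thetaIndex (pilotDataOfK T.D T.K)).Vbad →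
              Set ((logShellsDH (pilotDataOfK T.D T.K) logv).StarPacket v)) →
            ∀ (j : (thetaIndex (pilotDataOfK T.D T.K)).Label) (vQ : (thetaIndex (pilotDataOfK T.D T.K)).VQ),
              Set ((logShellsDH (pilotDataOfK T.D T.K) logv).Packet j vQ))
          (qK : ∀ v : (thetaIndex (pilotDataOfK T.D T.K)).V, v ∈ (thetaIndex (pilotDataOfK T.D T.K)).Vbad →
            Set ((logShellsDH (pilotDataOfK T.D T.K) logv).StarPacket v)),
          QPinned ({ toSituation := situationPrVol (pilotDataOfK T.D T.K) hlog M archPk archSub Ψ act Mmod region, col := col } :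
              LatticeSituation (thetaIndex (pilotDataOfK T.D T.K)))
            (settingPrVolSharp (pilotDataOfK T.D T.K) hlog M archPk archSub Ψ act Mmod region n lat sig split qData tq t htq0 htq1) ρ qK ∧
          PilotKummerCompatHull ({ toSituation := situationPrVol (pilotDataOfK T.D T.K) hlog M archPk archSub Ψ act Mmod region, col := col } :
              LatticeSituation (thetaIndex (pilotDataOfK T.D T.K)))
            (settingPrVolSharp (pilotDataOfK T.D T.K) hlog M archPk archSub Ψ act Mmod region n lat sig split qData tq t htq0 htq1) ρ qK :=
  WRow.exists_qPinned_and_hull_triple_slot_of_localType_diff isABCTriple_frey99794037551104 (by rw [Cor22.jInv_ratPoint_triple isABCTriple_frey99794037551104]; norm_num) T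
    (fun p => if p = 3 then 7 else if p = 5 then 7 else if p = 11 then 1 else if p = 13 then 1 else if p = 97 then 2 else if p = 179 then 1 else if p = 223 then 1 else if p = 409 then 0 else if p = 2141 then 0 else 0) (fun p => if p = 3 then 7 else if p = 5 then 7 else if p = 11 then 1 else if p = 13 then 1 else if p = 97 then 2 else if p = 179 then 1 else if p = 223 then 1 else if p = 409 then 0 else if p = 2141 then 0 else 0) (fun p e => (5 = p → e = 20 * l) ∧ (97 = p → e = 6 * l))
    (by
      intro pp x _
      refine ⟨fun hpp => ?_, fun hpp => ?_⟩
      · obtain rfl : pp = ⟨5, by norm_num⟩ := Subtype.ext hpp.symm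
        have h := GenuineK.absRamificationIdx_kOf_eq_wildUnit_of_triple (p' := 3) (v := 15) isABCTriple_frey99794037551104 T ⟨5, by norm_num⟩
          (Or.inr ⟨rfl, rfl⟩) (by simp; omega) (by norm_num) (by norm_num) (by norm_num) (by norm_num) (by norm_num) (by norm_num)
        rw [h x]; norm_num
      · obtain rfl : pp = ⟨97, by norm_num⟩ := Subtype.ext hpp.symm
        exact hloc x) 5 (fun e => e + e / 5 - 1)
    (by
      intro pp x _ hpp
      obtain rfl : pp = ⟨5, by norm_num⟩ := Subtype.ext hpp
      have h := GenuineK.differentOrd_kOf_eq_wildUnit_of_triple (p' := 3) (v := 15) isABCTriple_frey99794037551104 T ⟨5, by norm_num⟩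
        (Or.inr ⟨rfl, rfl⟩) (by simp; omega) (by norm_num) (by norm_num) (by norm_num) (by norm_num) (by norm_num) (by norm_num)
      exact (h x).symm.le)
    (RefBand.inhcell_99794037551104_type_diff hl hl0)

end Summit.ABC.IUTFork.Conditional

end
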